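import Mathlib
import Summits.PneNP.PneNP.Theorems.OverlapGapAlgebraSolvableImpliesStableSectionMonotoneRepairLocal

/-!
# PneNP / OverlapGapAlgebra — crux `SolvableImpliesStableSection` (stmt-PneNP-2463):
# the UNIT CLAUSE block (3/·) — the unit-clause states are a bounded-radius local rule

Support for crux `stmt-PneNP-2463` (`Summit.PneNP.PneNP.Theses.OverlapGapAlgebra.SolvableImpliesStableSection`),
registered stub `stub_lowDensity` (child G).  The state of a variable `v` after `t` rounds of the
localized unit-clause dynamics (`…UnitClauseObjects`) is determined by the label of `v` and the clauses
within co-occurrence distance `t` of `v`: the state at round `t + 1` is computed from the states at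
round `t` of the variables of the clauses containing `v` (unit test, least unit clause, demanded sign)
and from the label window of `v`.  In the hypothesis shape of the radius-`r` local-rule interface
(`shwRad_hamming_le` / `sissMV_concl_of_localMean`):

* `sissU_st_transfer` — if `Φ`, `Φ'` agree on every clause seen from `v` within radius `Rad` (in
  either instance), then `st S t Φ w = st S t Φ' w` for every `w` at co-occurrence distance `q` from `v`
  with `q + t ≤ Rad`;
* `sissU_local` — in particular `st S Rad Φ v = st S Rad Φ' v`.
All objects are hypotheses; no definitions; axioms `propext`, `Classical.choice`, `Quot.sound`.
-/

set_option linter.dupNamespace false -- `Summit.PneNP.PneNP.…`: summit = sub-problem (D-0017)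

namespace Summit.PneNP.PneNP.Theorems

open Finset
open scoped Classical

section Local

variable {m k n : ℕ} {R : ℕ}

/-- **Locality of the unit-clause states, walk form.** If `Φ` and `Φ'` agree on every clause that `v`
sees within radius `Rad` (in either instance), then for every round `t`, every `q` with `q + t ≤ Rad`
and every variable `w` reached from `v` by a co-occurrence walk of length `q` in `Φ`:
`st S t Φ w = st S t Φ' w`. -/
theorem sissU_st_transfer
    (st : Finset (Fin m) → ℕ → (Fin m → Fin k → Fin n × Bool) → Fin n → Option Bool)
    (dm : Finset (Fin m) → ℕ → (Fin m → Fin k → Fin n × Bool) → Fin n → Bool)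
    (h0 : ∀ (S : Finset (Fin m)) (Φ : Fin m → Fin k → Fin n × Bool) (v : Fin n), st S 0 Φ v = none)
    (hstep : ∀ (S : Finset (Fin m)) (t : ℕ) (Φ : Fin m → Fin k → Fin n × Bool) (v : Fin n),
      st S (t + 1) Φ v =
        if st S t Φ v = none then
          (if ∃ i : Fin m, i ∉ S ∧ ∃ j : Fin k, (Φ i j).1 = v ∧ ∀ j' : Fin k, j' ≠ j →
              st S t Φ (Φ i j').1 ≠ none ∧ st S t Φ (Φ i j').1 ≠ some (Φ i j').2
            then some (dm S t Φ v)
            else if (v : ℕ) * R / n = t then some true else none)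
        else st S t Φ v)
    (hdm : ∀ (S : Finset (Fin m)) (t : ℕ) (Φ : Fin m → Fin k → Fin n × Bool) (v : Fin n) (i : Fin m)
      (j : Fin k), i ∉ S → (Φ i j).1 = v → st S t Φ v = none →
      (∀ j' : Fin k, j' ≠ j → st S t Φ (Φ i j').1 ≠ none ∧ st S t Φ (Φ i j').1 ≠ some (Φ i j').2) →
      (∀ i' : Fin m, i' ∉ S → (∃ j₁ : Fin k, (Φ i' j₁).1 = v ∧ ∀ j' : Fin k, j' ≠ j₁ →
        st S t Φ (Φ i' j').1 ≠ none ∧ st S t Φ (Φ i' j').1 ≠ some (Φ i' j').2) → i ≤ i') →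
      dm S t Φ v = (Φ i j).2)
    (S : Finset (Fin m)) (Rad : ℕ) (Φ Φ' : (Fin m → Fin k → Fin n × Bool)) (v : Fin n)
    (H : ∀ i : Fin m,
      ((∃ j : Fin k, ∃ p : ℕ → Fin n, p 0 = v ∧ p Rad = (Φ i j).1 ∧ ∀ s, s < Rad → (p s = p (s + 1) ∨
          ∃ i' : Fin m, ∃ j₁ j₂ : Fin k, (Φ i' j₁).1 = p s ∧ (Φ i' j₂).1 = p (s + 1))) ∨
       (∃ j : Fin k, ∃ p : ℕ → Fin n, p 0 = v ∧ p Rad = (Φ' i j).1 ∧ ∀ s, s < Rad → (p s = p (s + 1) ∨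
          ∃ i' : Fin m, ∃ j₁ j₂ : Fin k, (Φ' i' j₁).1 = p s ∧ (Φ' i' j₂).1 = p (s + 1)))) →
      Φ i = Φ' i) :
    ∀ (t : ℕ) (w : Fin n) (q : ℕ), q + t ≤ Rad →
      (∃ p : ℕ → Fin n, p 0 = v ∧ p q = w ∧ ∀ s, s < q → (p s = p (s + 1) ∨
          ∃ i' : Fin m, ∃ j₁ j₂ : Fin k, (Φ i' j₁).1 = p s ∧ (Φ i' j₂).1 = p (s + 1))) →
      st S t Φ w = st S t Φ' w := by
  -- the symmetric agreement hypothesis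
  have H' : ∀ i : Fin m,
      ((∃ j : Fin k, ∃ p : ℕ → Fin n, p 0 = v ∧ p Rad = (Φ' i j).1 ∧ ∀ s, s < Rad → (p s = p (s + 1) ∨
          ∃ i' : Fin m, ∃ j₁ j₂ : Fin k, (Φ' i' j₁).1 = p s ∧ (Φ' i' j₂).1 = p (s + 1))) ∨
       (∃ j : Fin k, ∃ p : ℕ → Fin n, p 0 = v ∧ p Rad = (Φ i j).1 ∧ ∀ s, s < Rad → (p s = p (s + 1) ∨
          ∃ i' : Fin m, ∃ j₁ j₂ : Fin k, (Φ i' j₁).1 = p s ∧ (Φ i' j₂).1 = p (s + 1)))) →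
      Φ' i = Φ i := fun i h => (H i h.symm).symm
  intro t
  induction t with
  | zero =>
    intro w q _ _
    rw [h0, h0]
  | succ t ih =>
    intro w q hqt hreach
    obtain ⟨p, hp0, hpq, hpath⟩ := hreach
    -- a clause containing `w` (in either instance) agrees, and its variables satisfy the IH at round `t`
    have hclause : ∀ (i : Fin m) (jw : Fin k), ((Φ i jw).1 = w ∨ (Φ' i jw).1 = w) →
        Φ i = Φ' i ∧ ∀ j : Fin k, st S t Φ (Φ i j).1 = st S t Φ' (Φ i j).1 := by
      intro i jw hw
      have hi : Φ i = Φ' i := by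
        rcases hw with hw | hw
        · exact H i (Or.inl (sissR_sees_of_reach Φ v i jw q Rad (by omega) p hp0 (by rw [hpq, hw]) hpath))
        · refine (H' i (Or.inl (sissR_sees_of_reach Φ' v i jw q Rad (by omega) p hp0 (by rw [hpq, hw])
            fun s hs => ?_))).symm
          rcases hpath s hs with h | ⟨i', j₁, j₂, h₁, h₂⟩
          · exact Or.inl h
          · have hi' : Φ i' = Φ' i' :=
              H i' (Or.inl (sissR_sees_of_reach Φ v i' j₁ s Rad (by omega) p hp0 h₁.symm
                fun s' hs' => hpath s' (by omega)))
            exact Or.inr ⟨i', j₁, j₂, by rw [← hi']; exact h₁, by rw [← hi']; exact h₂⟩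
      have hwi : (Φ i jw).1 = w := by
        rcases hw with hw | hw
        · exact hw
        · rw [hi]; exact hw
      -- the walk extended by one step inside clause `i`
      have hreach' : ∀ j : Fin k, ∃ p' : ℕ → Fin n, p' 0 = v ∧ p' (q + 1) = (Φ i j).1 ∧
          ∀ s, s < q + 1 → (p' s = p' (s + 1) ∨
            ∃ i' : Fin m, ∃ j₁ j₂ : Fin k, (Φ i' j₁).1 = p' s ∧ (Φ i' j₂).1 = p' (s + 1)) := by
        intro j
        refine ⟨fun s => if s ≤ q then p s else (Φ i j).1, by
            dsimp only; rw [if_pos (Nat.zero_le q), hp0], by dsimp only; rw [if_neg (by omega)], ?_⟩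
        intro s hs
        dsimp only
        rcases Nat.lt_or_ge s q with hsq | hsq
        · rw [if_pos hsq.le, if_pos (Nat.succ_le_of_lt hsq)]
          exact hpath s hsq
        · have hs' : s = q := by omega
          subst hs'
          right
          refine ⟨i, jw, j, ?_, ?_⟩
          · rw [if_pos le_rfl, hpq]; exact hwi
          · rw [if_neg (by omega)]
      exact ⟨hi, fun j => ih (Φ i j).1 (q + 1) (by omega) (hreach' j)⟩
    have hval : st S t Φ w = st S t Φ' w := ih w q (by omega) ⟨p, hp0, hpq, hpath⟩
    -- the unit predicates of a clause `i` on `w` agree (in both directions of rewriting)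
    have hunit_iff : ∀ i : Fin m, (i ∉ S ∧ ∃ j : Fin k, (Φ i j).1 = w ∧ ∀ j' : Fin k, j' ≠ j →
          st S t Φ (Φ i j').1 ≠ none ∧ st S t Φ (Φ i j').1 ≠ some (Φ i j').2) ↔
        (i ∉ S ∧ ∃ j : Fin k, (Φ' i j).1 = w ∧ ∀ j' : Fin k, j' ≠ j →
          st S t Φ' (Φ' i j').1 ≠ none ∧ st S t Φ' (Φ' i j').1 ≠ some (Φ' i j').2) := by
      intro i
      constructor
      · rintro ⟨hiS, j, hj, hrest⟩
        obtain ⟨hi, hvals⟩ := hclause i j (Or.inl hj)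
        refine ⟨hiS, j, by rw [← hi]; exact hj, fun j' hj' => ?_⟩
        rw [← hi, ← hvals j']
        exact hrest j' hj'
      · rintro ⟨hiS, j, hj, hrest⟩
        obtain ⟨hi, hvals⟩ := hclause i j (Or.inr hj)
        refine ⟨hiS, j, by rw [hi]; exact hj, fun j' hj' => ?_⟩
        rw [hvals j', hi]
        exact hrest j' hj'
    have hex_iff : (∃ i : Fin m, i ∉ S ∧ ∃ j : Fin k, (Φ i j).1 = w ∧ ∀ j' : Fin k, j' ≠ j →
          st S t Φ (Φ i j').1 ≠ none ∧ st S t Φ (Φ i j').1 ≠ some (Φ i j').2) ↔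
        (∃ i : Fin m, i ∉ S ∧ ∃ j : Fin k, (Φ' i j).1 = w ∧ ∀ j' : Fin k, j' ≠ j →
          st S t Φ' (Φ' i j').1 ≠ none ∧ st S t Φ' (Φ' i j').1 ≠ some (Φ' i j').2) :=
      exists_congr hunit_iff
    -- the step at `w`
    rw [hstep S t Φ w, hstep S t Φ' w, ← hval]
    by_cases hw0 : st S t Φ w = none
    · rw [if_pos hw0, if_pos hw0]
      by_cases hex : ∃ i : Fin m, i ∉ S ∧ ∃ j : Fin k, (Φ i j).1 = w ∧ ∀ j' : Fin k, j' ≠ j →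
          st S t Φ (Φ i j').1 ≠ none ∧ st S t Φ (Φ i j').1 ≠ some (Φ i j').2
      · rw [if_pos hex, if_pos (hex_iff.1 hex)]
        -- the demanded values agree: both are the sign of `w` in the least unit clause `i₀`
        have hTne : (univ.filter fun i : Fin m => i ∉ S ∧ ∃ j : Fin k, (Φ i j).1 = w ∧
            ∀ j' : Fin k, j' ≠ j → st S t Φ (Φ i j').1 ≠ none ∧ st S t Φ (Φ i j').1 ≠ some (Φ i j').2).Nonempty := by
          obtain ⟨i, hi⟩ := hex
          exact ⟨i, by simp only [mem_filter, mem_univ, true_and]; exact hi⟩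
        obtain ⟨i₀, hi₀mem, hi₀le⟩ : ∃ i₀ : Fin m, (i₀ ∈ univ.filter fun i : Fin m => i ∉ S ∧
            ∃ j : Fin k, (Φ i j).1 = w ∧ ∀ j' : Fin k, j' ≠ j → st S t Φ (Φ i j').1 ≠ none ∧
              st S t Φ (Φ i j').1 ≠ some (Φ i j').2) ∧
            ∀ i' ∈ (univ.filter fun i : Fin m => i ∉ S ∧ ∃ j : Fin k, (Φ i j).1 = w ∧
              ∀ j' : Fin k, j' ≠ j → st S t Φ (Φ i j').1 ≠ none ∧ st S t Φ (Φ i j').1 ≠ some (Φ i j').2),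
              i₀ ≤ i' :=
          ⟨_, min'_mem _ hTne, fun i' hi' => min'_le _ i' hi'⟩
        simp only [mem_filter, mem_univ, true_and] at hi₀mem hi₀le
        obtain ⟨hi₀S, j₀, hj₀, hrest₀⟩ := hi₀mem
        have hleast : ∀ i' : Fin m, i' ∉ S → (∃ j₁ : Fin k, (Φ i' j₁).1 = w ∧ ∀ j' : Fin k, j' ≠ j₁ →
            st S t Φ (Φ i' j').1 ≠ none ∧ st S t Φ (Φ i' j').1 ≠ some (Φ i' j').2) → i₀ ≤ i' :=
          fun i' hi'S hi' => hi₀le i' ⟨hi'S, hi'⟩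
        have hd : dm S t Φ w = (Φ i₀ j₀).2 := hdm S t Φ w i₀ j₀ hi₀S hj₀ hw0 hrest₀ hleast
        obtain ⟨hi₀, hvals₀⟩ := hclause i₀ j₀ (Or.inl hj₀)
        have hd' : dm S t Φ' w = (Φ' i₀ j₀).2 := by
          refine hdm S t Φ' w i₀ j₀ hi₀S (by rw [← hi₀]; exact hj₀) (by rw [← hval]; exact hw0)
            (fun j' hj' => by rw [← hi₀, ← hvals₀ j']; exact hrest₀ j' hj') fun i' hi'S hi' => ?_
          exact hleast i' hi'S ((hunit_iff i').2 ⟨hi'S, hi'⟩).2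
        rw [hd, hd', hi₀]
      · rw [if_neg hex, if_neg (fun h => hex (hex_iff.2 h))]
    · rw [if_neg hw0, if_neg hw0, hval]

/-- **The unit-clause states are a radius-`Rad` local rule.** If `Φ` and `Φ'` agree on every clause
that `v` sees within radius `Rad` (hypothesis shape `hloc` of `shwRad_hamming_le`), then
`st S Rad Φ v = st S Rad Φ' v`. -/
theorem sissU_local
    (st : Finset (Fin m) → ℕ → (Fin m → Fin k → Fin n × Bool) → Fin n → Option Bool)
    (dm : Finset (Fin m) → ℕ → (Fin m → Fin k → Fin n × Bool) → Fin n → Bool)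
    (h0 : ∀ (S : Finset (Fin m)) (Φ : Fin m → Fin k → Fin n × Bool) (v : Fin n), st S 0 Φ v = none)
    (hstep : ∀ (S : Finset (Fin m)) (t : ℕ) (Φ : Fin m → Fin k → Fin n × Bool) (v : Fin n),
      st S (t + 1) Φ v =
        if st S t Φ v = none then
          (if ∃ i : Fin m, i ∉ S ∧ ∃ j : Fin k, (Φ i j).1 = v ∧ ∀ j' : Fin k, j' ≠ j →
              st S t Φ (Φ i j').1 ≠ none ∧ st S t Φ (Φ i j').1 ≠ some (Φ i j').2
            then some (dm S t Φ v)
            else if (v : ℕ) * R / n = t then some true else none)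
        else st S t Φ v)
    (hdm : ∀ (S : Finset (Fin m)) (t : ℕ) (Φ : Fin m → Fin k → Fin n × Bool) (v : Fin n) (i : Fin m)
      (j : Fin k), i ∉ S → (Φ i j).1 = v → st S t Φ v = none →
      (∀ j' : Fin k, j' ≠ j → st S t Φ (Φ i j').1 ≠ none ∧ st S t Φ (Φ i j').1 ≠ some (Φ i j').2) →
      (∀ i' : Fin m, i' ∉ S → (∃ j₁ : Fin k, (Φ i' j₁).1 = v ∧ ∀ j' : Fin k, j' ≠ j₁ →
        st S t Φ (Φ i' j').1 ≠ none ∧ st S t Φ (Φ i' j').1 ≠ some (Φ i' j').2) → i ≤ i') →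
      dm S t Φ v = (Φ i j).2)
    (S : Finset (Fin m)) (Rad : ℕ) (Φ Φ' : (Fin m → Fin k → Fin n × Bool)) (v : Fin n)
    (H : ∀ i : Fin m,
      ((∃ j : Fin k, ∃ p : ℕ → Fin n, p 0 = v ∧ p Rad = (Φ i j).1 ∧ ∀ s, s < Rad → (p s = p (s + 1) ∨
          ∃ i' : Fin m, ∃ j₁ j₂ : Fin k, (Φ i' j₁).1 = p s ∧ (Φ i' j₂).1 = p (s + 1))) ∨
       (∃ j : Fin k, ∃ p : ℕ → Fin n, p 0 = v ∧ p Rad = (Φ' i j).1 ∧ ∀ s, s < Rad → (p s = p (s + 1) ∨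
          ∃ i' : Fin m, ∃ j₁ j₂ : Fin k, (Φ' i' j₁).1 = p s ∧ (Φ' i' j₂).1 = p (s + 1)))) →
      Φ i = Φ' i) :
    st S Rad Φ v = st S Rad Φ' v :=
  sissU_st_transfer st dm h0 hstep hdm S Rad Φ Φ' v H Rad v 0 (by omega)
    ⟨fun _ => v, rfl, rfl, fun s hs => absurd hs (Nat.not_lt_zero s)⟩

end Local

end Summit.PneNP.PneNP.Theorems
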